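import Mathlib
import Summits.ValiantsHypothesis.ValiantsHypothesis.Theorems.GeneratorObstructionsGenFlipThesisChowDichotomy
import Summits.ValiantsHypothesis.ValiantsHypothesis.Theorems.GeneratorObstructionsPerGenDegreeSuperQPHubPermanent

/-!
# Route GeneratorObstructions — crux K1 `PerGenDegreeSuperQP` (stmt-ValiantsHypothesis-11654), line
# `per-side-atoms`: the PADDED doubling gadget is a degeneration of the permanent

Helper file (`--supports stmt-ValiantsHypothesis-11654`).  The evaluation-lateness route to K1 needs a
point of `Δ(per_m)` carrying a long doubling chain.  The unpadded gadget
`Σ_j x_{B j}^k x_{A j}^{2k} x_{A' j}^{2k}` with `≥ 3` blocks is not a sign-free degeneration of `per_m`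
(Voorhoeve's bound on perfect matchings of cubic bipartite graphs; memo on the item), but the PADDED
gadget is: by the hub substitution (`…PerGenDegreeSuperQPHubPermanent`, `permanent_hubMat`) and
`End · per_m ⊆ Δ(per_m)`:

* `padded_blockSum_mem_orbitClosure_perPoly` — for `m` indexed by `Option (Fin c × Fin L)` (`m = cL+1`)
  and ANY letters `zL`, `ℓ (j,t)` of the `m × m` matrix alphabet,
  `X zL ^ ((c-1)L+1) · Σ_j ∏_t X (ℓ (j,t)) ∈ Δ(per_m)` (own lexicographic letters);
* `padded_gadget_mem_orbitClosure_perPoly` — with `L = 5k` and the letters `B j` (×k), `A j` (×2k),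
  `A' j` (×2k): **`X zL ^ ((c-1)·5k+1) · Σ_{j<c} X(B j)^k X(A j)^{2k} X(A' j)^{2k} ∈ Δ(per_{5kc+1})`**.

What this is for: with the padding letter on TOP of the letter order the stabiliser of the padded
gadget still forces doubling along the interleaved chain (degree `≥ 2^c - 1`; to be typed as a padded
`gadget_lateness_package`), so K1 reduces to ONE padded certificate — a highest-weight vector of
nonconstant weight not vanishing at the padded gadget (memo v2 on the item).

Honest framing: an unconditional orbit-closure membership; no stub (`stub_atomLate`), crux or summit
is settled here; `VP ≠ VNP` untouched. [folklore]
-/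

namespace Summit.ValiantsHypothesis.ValiantsHypothesis.Theorems.GeneratorObstructions.PerGenDegreeSuperQP

open MvPolynomial
open Literature.NumberTheory.DiophantineGeometry Literature.Computability.AlgebraicComplexity

-- `Summit.ValiantsHypothesis.ValiantsHypothesis.…` is the tree's mandated single-conjunct layout.
set_option linter.dupNamespace false

noncomputable section

section Membership

variable {c L : ℕ}

/-- The letter pattern of the hub substitution: entry `(x, y)` of the generic matrix is sent to the
letter `zL` / `ℓ p` / `0` exactly as in `hubMat`. [folklore] -/
theorem exists_linSubst_eq_hubMat {m : ℕ} (e : Fin m ≃ Option (Fin c × Fin L)) (zL : MatIdx m)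
    (ℓ : Fin c × Fin L → MatIdx m) :
    ∃ D : Matrix (MatIdx m) (MatIdx m) ℂ, ∀ i i' : Fin m,
      linSubst (MatIdx m) ℂ D (X (toLex (i, i'))) =
        hubMat (X zL : MvPolynomial (MatIdx m) ℂ) (fun p => X (ℓ p)) (e i) (e i') := by
  classical
  -- the letter (if any) of entry `w`
  let letter : MatIdx m → Option (MatIdx m) := fun w =>
    match e (ofLex w).1, e (ofLex w).2 with
    | none, none => none
    | none, some q => if q.2.val = 0 then some zL else none
    | some p, none => if p.2.val = L - 1 then some (ℓ p) else none
    | some p, some q => if p = q then some zL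
        else if p.1 = q.1 ∧ q.2.val = p.2.val + 1 then some (ℓ p) else none
  refine ⟨Matrix.of fun u w => if letter w = some u then 1 else 0, fun i i' => ?_⟩
  have key : linSubst (MatIdx m) ℂ (Matrix.of fun u w => if letter w = some u then (1 : ℂ) else 0)
      (X (toLex (i, i'))) = ((letter (toLex (i, i'))).map X).getD 0 := by
    rw [linSubst_X]
    cases hl : letter (toLex (i, i')) with
    | none =>
      simp only [Option.map_none, Option.getD_none]
      refine Finset.sum_eq_zero fun u _ => ?_
      rw [Matrix.of_apply, hl]; simp
    | some v =>
      simp only [Option.map_some, Option.getD_some]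
      rw [Finset.sum_eq_single v]
      · rw [Matrix.of_apply, hl, if_pos rfl, one_smul]
      · intro u _ hu; rw [Matrix.of_apply, hl, if_neg (fun h => hu (Option.some.inj h).symm), zero_smul]
      · intro h; exact absurd (Finset.mem_univ v) h
  rw [key]
  simp only [letter, ofLex_toLex]
  rcases hx : e i with _ | p <;> rcases hy : e i' with _ | q <;> simp only [hubMat]
  · rfl
  · split_ifs <;> rfl
  · split_ifs <;> rfl
  · split_ifs <;> rfl

/-- **The padded block sum is a degeneration of the permanent.**  For `m = cL + 1` (`L ≥ 1`) and any
letters `zL`, `ℓ (j,t)` of the `m × m` matrix alphabet,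
`X zL ^ ((c-1)L+1) · Σ_{j<c} ∏_{t<L} X (ℓ (j,t)) ∈ Δ(per_m)` (own lexicographic letters): it is the
image of `per_m` under the hub substitution (`permanent_hubMat`), and `End · per_m ⊆ Δ(per_m)`.
[folklore] -/
theorem padded_blockSum_mem_orbitClosure_perPoly {m : ℕ} (hL : 1 ≤ L)
    (e : Fin m ≃ Option (Fin c × Fin L)) (zL : MatIdx m) (ℓ : Fin c × Fin L → MatIdx m) :
    ((X zL) ^ ((c - 1) * L + 1) * ∑ j : Fin c, ∏ t : Fin L, X (ℓ (j, t)) :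
        MvPolynomial (MatIdx m) ℂ) ∈
      orbitClosure (rename toLex (perPoly (Fin m) ℂ) : MvPolynomial (MatIdx m) ℂ) := by
  classical
  obtain ⟨D, hD⟩ := exists_linSubst_eq_hubMat e zL ℓ
  refine endOrbit_subset_orbitClosure_holds _ ⟨D, ?_⟩
  change linSubst (MatIdx m) ℂ D (rename _ (perPoly (Fin m) ℂ)) = _
  set ψ : MvPolynomial (Fin m × Fin m) ℂ →ₐ[ℂ] MvPolynomial (MatIdx m) ℂ :=
    (linSubst (MatIdx m) ℂ D).comp (rename (toLex : Fin m × Fin m → MatIdx m)) with hψ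
  have hψX : ∀ i i', ψ (X (i, i')) =
      hubMat (X zL : MvPolynomial (MatIdx m) ℂ) (fun p => X (ℓ p)) (e i) (e i') := by
    intro i i'
    rw [hψ, AlgHom.comp_apply, rename_X, hD]
  have hper : ψ (perPoly (Fin m) ℂ) = (ψ.mapMatrix (Matrix.mvPolynomialX (Fin m) (Fin m) ℂ)).permanent := by
    simp only [perPoly, Matrix.permanent, map_sum, map_prod, AlgHom.mapMatrix_apply, Matrix.map_apply]
  have hmat : ψ.mapMatrix (Matrix.mvPolynomialX (Fin m) (Fin m) ℂ) =
      (hubMat (X zL : MvPolynomial (MatIdx m) ℂ) (fun p => X (ℓ p))).submatrix e e := by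
    refine Matrix.ext fun i i' => ?_
    rw [AlgHom.mapMatrix_apply, Matrix.map_apply, Matrix.mvPolynomialX_apply, hψX, Matrix.submatrix_apply]
  have : linSubst (MatIdx m) ℂ D (rename toLex (perPoly (Fin m) ℂ)) = ψ (perPoly (Fin m) ℂ) := by
    rw [hψ, AlgHom.comp_apply]
  rw [this, hper, hmat, permanent_submatrix_equiv, permanent_hubMat hL, Finset.mul_sum]

/-- The gadget letters of block `j`: `B j` on the first `k` rows, `A j` on the next `2k`, `A' j` on the
last `2k`. [folklore] -/
def gadgetLetter {σ : Type*} (k : ℕ) (B A A' : Fin c → σ) (p : Fin c × Fin (5 * k)) : σ :=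
  if p.2.val < k then B p.1 else if p.2.val < 3 * k then A p.1 else A' p.1

/-- The block product of the gadget letters is the gadget monomial. [folklore] -/
theorem prod_X_gadgetLetter {σ : Type*} (k : ℕ) (B A A' : Fin c → σ) (j : Fin c) :
    (∏ t : Fin (5 * k), (X (gadgetLetter k B A A' (j, t)) : MvPolynomial σ ℂ)) =
      X (B j) ^ k * (X (A j) ^ (2 * k) * X (A' j) ^ (2 * k)) := by
  rw [show (∏ t : Fin (5 * k), (X (gadgetLetter k B A A' (j, t)) : MvPolynomial σ ℂ)) =
      ∏ t : Fin (5 * k), (fun n : ℕ => (X (if n < k then B j else if n < 3 * k then A j else A' j) :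
        MvPolynomial σ ℂ)) t.val from rfl,
    Fin.prod_univ_eq_prod_range (fun n : ℕ => (X (if n < k then B j else if n < 3 * k then A j
      else A' j) : MvPolynomial σ ℂ)) (5 * k)]
  rw [show 5 * k = k + (2 * k + 2 * k) by ring, Finset.prod_range_add, Finset.prod_range_add]
  congr 1
  · rw [Finset.prod_congr rfl (g := fun _ => (X (B j) : MvPolynomial σ ℂ)) (fun t ht => by
      rw [Finset.mem_range] at ht; rw [if_pos ht]), Finset.prod_const, Finset.card_range]
  · congr 1
    · rw [Finset.prod_congr rfl (g := fun _ => (X (A j) : MvPolynomial σ ℂ)) (fun t ht => by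
        rw [Finset.mem_range] at ht; rw [if_neg (by omega), if_pos (by omega)]), Finset.prod_const,
        Finset.card_range]
    · rw [Finset.prod_congr rfl (g := fun _ => (X (A' j) : MvPolynomial σ ℂ)) (fun t ht => by
        rw [Finset.mem_range] at ht; rw [if_neg (by omega), if_neg (by omega)]), Finset.prod_const,
        Finset.card_range]

/-- **The padded doubling gadget is a degeneration of the permanent**: for `m = 5kc + 1` (`k ≥ 1`) and
any letters `zL, B j, A j, A' j` of the `m × m` matrix alphabet,
`X zL ^ (m - 5k) · Σ_{j<c} X (B j)^k X (A j)^{2k} X (A' j)^{2k} ∈ Δ(per_m)`. [folklore] -/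
theorem padded_gadget_mem_orbitClosure_perPoly {m k : ℕ} (hk : 1 ≤ k)
    (e : Fin m ≃ Option (Fin c × Fin (5 * k))) (zL : MatIdx m) (B A A' : Fin c → MatIdx m) :
    ((X zL) ^ ((c - 1) * (5 * k) + 1) *
        ∑ j : Fin c, X (B j) ^ k * (X (A j) ^ (2 * k) * X (A' j) ^ (2 * k)) :
        MvPolynomial (MatIdx m) ℂ) ∈
      orbitClosure (rename toLex (perPoly (Fin m) ℂ) : MvPolynomial (MatIdx m) ℂ) := by
  have h := padded_blockSum_mem_orbitClosure_perPoly (by omega) e zL (gadgetLetter k B A A')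
  simp_rw [prod_X_gadgetLetter] at h
  exact h

end Membership

end

end Summit.ValiantsHypothesis.ValiantsHypothesis.Theorems.GeneratorObstructions.PerGenDegreeSuperQP
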